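import Mathlib.Algebra.BigOperators.Fin
import Literature.IUT.HodgeTheaters.PuncturedEllipticArrowModelDatum
import Literature.IUT.HodgeTheaters.PuncturedEllipticCoveringsZeroCuspRamified
import HarnessLib

/-!
# The oriented-inertia inputs (gen)(rel)(inv) HOLD in the genuine §1 model — non-vacuity of `not_inertia_ε0_le_piXarrow_of_orientedInertia` (proof-only witness)

Mochizuki, *Inter-universal Teichmüller theory I*, kurims manuscript (May 2020), §1 pp. 37–39, proof of
Cor. 1.2 p. 39 (the clause «… whose image in `Gal(X̲→/X̲)` is nontrivial» for `ε⁰`) ([IUTchI] Cor 1.2 p.39)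
[claim: Mochizuki2012, status: disputed] (D-0012 claim key; series status DISPUTED — WITNESS-class, proof-only,
pure finite group theory over abc-iut-L5-t1's model `PuncturedEllipticArrowModel*.lean`; nothing of the series is
asserted, no side is taken on [IUTchIII] Cor. 3.12).

`PuncturedEllipticCoveringsZeroCuspRamified.lean` derives the `ε⁰`-clause `¬ I_{ε⁰} ⊆ Π_{X̲→}` from
`ArrowCoveringClaims ∧ ArrowOpenClaims` plus three étale-π₁ structure inputs: (gen) oriented topological
generators `z_x ∈ I_x`, (rel) the surface relation `∏_i z_{e(i)} ∈ closure [Δ_X̲, Δ_X̲]`, (inv) `ι̲` carries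
`z_{ε′}` to `z_{ε″}` mod `Ker(Δ_X̲ ↠ Δ_X̲^{ab} ⊗ ℤ/l)`.  Here these inputs are EXHIBITED at the genuine finite
model `ArrowModel.datum` (`z_i := ĉ_i = (B_{i+1} − B_i, 1)`, the single relation `Σ_i c_i = 0`, `σ_0(c_1) = c_{−1}`)
— `ArrowModel.datum_orientedInertiaInputs` — so the hypotheses of the derivation are JOINTLY satisfiable with
every typed §1 predicate (`ArrowModel.exists_sectionOne_model`), and the derivation FIRES end to end
(inside `ArrowModel.exists_sectionOne_model_orientedInertia`).  (Contrast: the unoriented variant `udatum` violates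
(rel) and (inv) and has `I_{ε⁰} ⊆ Π_{X̲→}` — `PuncturedEllipticArrowModelUnorientedDatum.lean`.)
PROOF-ONLY; symbolic `l`; axioms standard.  Witnessed ≠ endorsed.
-/

namespace Literature.IUT.HodgeTheaters

namespace PuncturedEllipticData

namespace ArrowModel

open DihedralGroup
open scoped Pointwise

variable (l : ℕ)

/-- **The surface relation of the model**: `Σ_i c_i = Σ_i (B_{i+1} − B_i) = 0` in `N`.
([IUTchI] §1 p.37) [claim: Mochizuki2012, status: disputed] -/
theorem sum_cvec_eq_zero [NeZero l] : ∑ x : ZMod l, cvec l x = 0 := by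
  have h1 : ∀ x : ZMod l, cvec l x = (((0 : ZMod l), δ l (x + 1)) : V l) - ((0 : ZMod l), δ l x) := by
    intro x
    simp only [cvec, Prod.mk_sub_mk, sub_zero]
  calc ∑ x : ZMod l, cvec l x
      = ∑ x : ZMod l, ((((0 : ZMod l), δ l (x + 1)) : V l) - ((0 : ZMod l), δ l x)) :=
        Finset.sum_congr rfl fun x _ => h1 x
    _ = ∑ x : ZMod l, (((0 : ZMod l), δ l (x + 1)) : V l) - ∑ x : ZMod l, (((0 : ZMod l), δ l x) : V l) :=
        Finset.sum_sub_distrib _ _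
    _ = 0 := by
        rw [sub_eq_zero]
        exact Equiv.sum_comp (Equiv.addRight (1 : ZMod l)) (fun x => (((0 : ZMod l), δ l x) : V l))

/-- A product of inertia elements `ĉ_{f(i)}` is `inN` of the sum of the inertia vectors (`N` is abelian).
[claim: Mochizuki2012, status: disputed] -/
theorem prod_ofFn_chat {n : ℕ} (f : Fin n → ZMod l) :
    (List.ofFn fun i => chat l (f i)).prod = inN l (∑ i, cvec l (f i)) := by
  have e : (List.ofFn fun i => chat l (f i)) =
      (List.ofFn fun i => Multiplicative.ofAdd (cvec l (f i))).map
        (SemidirectProduct.inl : N l →* G l) := by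
    rw [List.map_ofFn]; rfl
  rw [e, ← map_list_prod, Fin.prod_ofFn, ← ofAdd_sum]
  rfl

section Witness

variable {l} (h5 : 5 ≤ l) (h6 : Nat.Coprime l 6)

/-- **(gen)(rel)(inv) hold in the genuine model** with `z_i := ĉ_i`: every `ĉ_i ∈ I_i`; `I_{ε′} = ⟨ĉ_1⟩`;
the surface relation `∏_i ĉ_{e(i)} = (Σ_x c_x, 1) = 1` for any enumeration `e` of the cusps; and
`ŝ ĉ_1 ŝ⁻¹ = ĉ_{−1}` (`σ_0(c_1) = c_{−1}`: the involution respects the orientation).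
([IUTchI] Cor 1.2 p.39) [claim: Mochizuki2012, status: disputed] -/
theorem datum_orientedInertiaInputs :
    ∃ z : (datum l h5 h6).Cusp → (datum l h5 h6).PiC,
      (∀ x, z x ∈ (datum l h5 h6).inertia x) ∧
      (datum l h5 h6).inertia (datum l h5 h6).ε1 ≤
        (Subgroup.zpowers (z (datum l h5 h6).ε1)).topologicalClosure ∧
      (∃ (n : ℕ) (e : Fin n ≃ (datum l h5 h6).Cusp), (List.ofFn fun i => z (e i)).prod ∈
        (⁅(datum l h5 h6).DeltaXbar, (datum l h5 h6).DeltaXbar⁆).topologicalClosure) ∧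
      (∃ c ∈ (datum l h5 h6).PiCbar, c ∉ (datum l h5 h6).PiX ∧ ∃ t ∈ (datum l h5 h6).PiXbar,
        (t * c) * z (datum l h5 h6).ε1 * (t * c)⁻¹ * (z (datum l h5 h6).ε2)⁻¹ ∈ (datum l h5 h6).modLKer) := by
  haveI : NeZero l := ⟨by omega⟩
  refine ⟨fun x => chat l x, fun x => ?_, ?_, ?_, ?_⟩
  · rw [inertia_eq]; exact Subgroup.mem_zpowers _
  · rw [inertia_eq]
    intro g hg
    exact Subgroup.le_topologicalClosure _ hg
  · refine ⟨Fintype.card (ZMod l), (Fintype.equivFin (ZMod l)).symm, ?_⟩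
    change (List.ofFn fun i => chat l ((Fintype.equivFin (ZMod l)).symm i)).prod ∈
      (⁅(datum l h5 h6).DeltaXbar, (datum l h5 h6).DeltaXbar⁆).topologicalClosure
    rw [prod_ofFn_chat, Equiv.sum_comp (Fintype.equivFin (ZMod l)).symm (cvec l), sum_cvec_eq_zero,
      inN_zero]
    exact Subgroup.one_mem _
  · refine ⟨sigmaHat l, sigmaHat_mem_PiCbarm l, sigmaHat_not_mem_PiXm l, 1, Subgroup.one_mem _, ?_⟩
    have e : (1 : G l) * sigmaHat l * chat l 1 * ((1 : G l) * sigmaHat l)⁻¹ * (chat l (-1))⁻¹ = 1 := by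
      rw [one_mul, conj_chat, sigmaHat_right, cuspAct_sr, neg_zero, zero_sub, mul_inv_cancel]
    convert (datum l h5 h6).modLKer.one_mem using 2
    exact e

/-- **Joint non-vacuity**: for every `l ≥ 5` prime to `6` there is a `PuncturedEllipticData` satisfying all typed
§1 predicates AND carrying oriented inertia generators with (gen)(rel)(inv) — so the hypotheses of the
`ε⁰`-derivation are consistent with the typed record; the last conjunct `¬ I_{ε⁰} ⊆ Π_{X̲→}` is obtained in the
proof by FIRING `ArrowCoveringClaims.not_inertia_ε0_le_piXarrow_of_orientedInertia` on these inputs (end-to-end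
exercise of the derivation; cf. the direct computation `datum_not_inertia_ε0_le_piXarrow`).
([IUTchI] Cor 1.2 p.39) [claim: Mochizuki2012, status: disputed] -/
theorem exists_sectionOne_model_orientedInertia (h5 : 5 ≤ l) (h6 : Nat.Coprime l 6) :
    ∃ D : PuncturedEllipticData.{0}, D.l = l ∧ D.ArrowCoveringClaims ∧ D.Rmk121 ∧ D.ArrowOpenClaims ∧
      Nonempty D.CuspGalois ∧
      ∃ z : D.Cusp → D.PiC, (∀ x, z x ∈ D.inertia x) ∧
        D.inertia D.ε1 ≤ (Subgroup.zpowers (z D.ε1)).topologicalClosure ∧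
        (∃ (n : ℕ) (e : Fin n ≃ D.Cusp), (List.ofFn fun i => z (e i)).prod ∈
          (⁅D.DeltaXbar, D.DeltaXbar⁆).topologicalClosure) ∧
        (∃ c ∈ D.PiCbar, c ∉ D.PiX ∧ ∃ t ∈ D.PiXbar,
          (t * c) * z D.ε1 * (t * c)⁻¹ * (z D.ε2)⁻¹ ∈ D.modLKer) ∧
        ¬ D.inertia D.ε0 ≤ D.piXarrow :=
  by
    obtain ⟨z, hz, hgen, hrel, hinv⟩ := datum_orientedInertiaInputs h5 h6
    -- the last conjunct is obtained by FIRING the derivation of `…ZeroCuspRamified` on these inputs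
    exact ⟨datum l h5 h6, rfl, arrowCoveringClaims h5 h6, rmk121 h5 h6, arrowOpenClaims h5 h6,
      ⟨cuspGalois h5 h6⟩, z, hz, hgen, hrel, hinv,
      (arrowCoveringClaims h5 h6).not_inertia_ε0_le_piXarrow_of_orientedInertia (arrowOpenClaims h5 h6)
        z hz hgen hrel hinv⟩

end Witness

end ArrowModel

end PuncturedEllipticData

end Literature.IUT.HodgeTheaters
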